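import Literature.Computability.AlgebraicComplexity.DeterminantalComplexityProofs
import Literature.Computability.AlgebraicComplexity.StandardFamiliesProofs
import Literature.LinearAlgebra.Matrix.PermanentLaplace
import Mathlib.Algebra.BigOperators.Fin
import Mathlib.Logic.Equiv.Fin.Basic
import Mathlib.Data.Complex.Basic

/-!
# Stub `stub_deletion` (S2) of line `fat-row-recursion` — deleting a column block is exact surgery

Crux `DetQP.DetqpThesis` (stmt-ValiantsHypothesis-0315; routes DetQP / UlrichPadded), line
`fat-row-recursion`, registered stub S2, proved with exactly the registered signature
(`stub_deletion`).  A ROW-PARTITIONED affine determinantal representation of `per_{n+1}` of size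
`M` is an `M × M` matrix `A` of affine polynomials in the variables `X (r, c)` with
`det A = perPoly (Fin (n+1)) ℂ` (`IsAffineDetRepr`) and `β : Fin M → Fin (n+1)` such that matrix
row `a` reads only the variables of column `β a` (`coeff (single e 1) (A a b) ≠ 0 → e.2 = β a`);
block `j` is `{a | β a = j}`.  Claim: for every `j` there is a row-partitioned representation of
`per_n` of size `M'` with `M' + #{a | β a = j} ≤ M`.

Proof.
* SUBSTITUTION (`aeval_perPoly_succ`, `subst_affine`): `X (0, j) ↦ 1`, `X (r+1, j) ↦ 0`,
  `X (0, c) ↦ 0` and `X (r+1, j.succAbove c') ↦ X (r, c')`.  Laplace expansion of the permanent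
  along column `j` (`Matrix.permanent_eq_sum_column`) gives `per_{n+1} ↦ per_n` exactly, so the
  substituted matrix `A₂` has `det A₂ = per_n` (`AlgHom.map_det`), affine entries, the rows of
  block `j` become CONSTANT and a row of block `j.succAbove c'` reads only the new column `c'`:
  rows are recoloured by `finSuccEquiv' j ∘ β : Fin M → Option (Fin n)` (`none` = constant row).
* ONE ELIMINATION STEP (`elim_step`): if a square affine matrix `B` of size `m + 1` with
  `det B ≠ 0` has a constant row `a₀` (`B a₀ b = C (v b)`), pick `v b₀ ≠ 0`, subtract
  `(v b / v b₀) ·` column `b₀` from every other column (right multiplication by a unipotent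
  `1 + e_{b₀} wᵀ` of determinant `1`, `Matrix.det_one_add_replicateCol_mul_replicateRow`) and
  expand along row `a₀` (`Matrix.det_succ_row`): `det B = C κ · det B'`, `κ = ± v b₀ ≠ 0`, `B'` of
  size `m`.  Column operations act inside each row, so row `p` of `B'` consists of
  `K`-combinations of entries of row `a₀.succAbove p` of `B`: per-row supports are inherited.
  ITERATION (`elim_iter`) removes the `#{a | β a = j}` constant rows one at a time.
* ABSORPTION: the result has size `M' ≥ 1` since `per_n` (total degree `n ≥ 1`,
  `totalDegree_perPoly_holds`) is not a constant; scaling row `0` by `C κ`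
  (`Matrix.det_updateRow_smul`) gives `det A' = per_n`, affine, row-partitioned by
  `β' a = (γ' a).getD 0`.

Tree facts used (all proved): `Matrix.permanent_eq_sum_column`, `totalDegree_perPoly_holds`,
`perPoly_ne_zero`, `HasDetRepr.totalDegree_aeval_le_of_le_one`.  Mathlib otherwise; no named
facts, no `def`s. [folklore]
-/

-- single-conjunct layout: Sub = Summit, duplicated namespace component intended
set_option linter.dupNamespace false

noncomputable section

open MvPolynomial
open scoped BigOperators Matrix
open Literature.Computability.AlgebraicComplexity

namespace Summit.ValiantsHypothesis.ValiantsHypothesis.Theorems.DetQPDetqpThesis.FatRowDeletion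

/-! ## Affine bookkeeping -/

section Affine

variable {R : Type*} [CommSemiring R] {σ τ : Type*}

/-- A coefficient of a polynomial of total degree `≤ 1` at an exponent which is neither `0` nor a
unit vector vanishes (an exponent of degree `≤ 1` is `0` or some `single v 1`). [folklore] -/
theorem coeff_eq_zero_of_totalDegree_le_one {p : MvPolynomial σ R} (hp : p.totalDegree ≤ 1)
    {d : σ →₀ ℕ} (h0 : d ≠ 0) (h1 : ∀ v, d ≠ Finsupp.single v 1) : coeff d p = 0 := by
  by_contra h
  rcases Nat.le_one_iff_eq_zero_or_eq_one.1 ((le_totalDegree (mem_support_iff.mpr h)).trans hp)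
    with h | h
  · exact h0 ((Finsupp.degree_eq_zero_iff d).1 h)
  · obtain ⟨v, hv⟩ := (Finsupp.sum_eq_one_iff d).1 h
    exact h1 v hv

/-- **Affine expansion**: a polynomial of total degree `≤ 1` is
`C (coeff 0 p) + Σ_e C (coeff (single e 1) p) · X e`. [folklore] -/
theorem eq_C_add_sum_of_totalDegree_le_one [Fintype σ] {p : MvPolynomial σ R}
    (hp : p.totalDegree ≤ 1) :
    p = C (coeff 0 p) + ∑ e, C (coeff (Finsupp.single e 1) p) * X e := by
  classical
  ext d
  simp only [coeff_add, coeff_C, coeff_sum, coeff_C_mul, coeff_X]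
  by_cases hd0 : d = 0
  · subst hd0
    rw [if_pos rfl, Finset.sum_eq_zero (fun e _ => ?_), add_zero]
    rw [if_neg (Finsupp.single_ne_zero.mpr one_ne_zero), mul_zero]
  rw [if_neg (Ne.symm hd0), zero_add]
  by_cases hd1 : ∃ v, d = Finsupp.single v 1
  · obtain ⟨v, rfl⟩ := hd1
    rw [Finset.sum_eq_single v]
    · rw [if_pos rfl, mul_one]
    · intro w _ hwv
      rw [if_neg (fun h => hwv (Finsupp.single_left_injective one_ne_zero h)), mul_zero]
    · intro h
      exact absurd (Finset.mem_univ v) h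
  · push Not at hd1
    rw [coeff_eq_zero_of_totalDegree_le_one hp hd0 hd1, eq_comm]
    refine Finset.sum_eq_zero fun e _ => ?_
    rw [if_neg (fun h => hd1 e h.symm), mul_zero]

/-- If a linear coefficient `coeff_{e'} (p(a))` of a substitution into an affine `p` is nonzero,
some variable `X e` occurs linearly in `p` with `coeff_{e'} (a e) ≠ 0`
(`coeff_{e'} (p(a)) = Σ_e coeff_e p · coeff_{e'} (a e)`). [folklore] -/
theorem exists_coeff_ne_zero_of_coeff_aeval_ne_zero [Fintype σ] (a : σ → MvPolynomial τ R)
    {p : MvPolynomial σ R} (hp : p.totalDegree ≤ 1) {e' : τ}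
    (h : coeff (Finsupp.single e' 1) (aeval a p) ≠ 0) :
    ∃ e, coeff (Finsupp.single e 1) p ≠ 0 ∧ coeff (Finsupp.single e' 1) (a e) ≠ 0 := by
  rw [eq_C_add_sum_of_totalDegree_le_one hp] at h
  simp only [map_add, map_sum, map_mul, aeval_C, aeval_X, algebraMap_eq, coeff_add, coeff_sum,
    coeff_C_mul] at h
  rw [coeff_C_of_ne_zero (Finsupp.single_ne_zero.mpr one_ne_zero), zero_add] at h
  obtain ⟨e, -, he⟩ := Finset.exists_ne_zero_of_sum_ne_zero h
  exact ⟨e, left_ne_zero_of_mul he, right_ne_zero_of_mul he⟩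

/-- A polynomial of total degree `≤ 1` all of whose linear coefficients vanish is the constant
`C (coeff 0 p)`. [folklore] -/
theorem eq_C_of_forall_coeff_single_eq_zero {p : MvPolynomial σ R} (hp : p.totalDegree ≤ 1)
    (h0 : ∀ e, coeff (Finsupp.single e 1) p = 0) : p = C (coeff 0 p) := by
  classical
  ext d
  rw [coeff_C]
  by_cases hd : 0 = d
  · subst hd
    rw [if_pos rfl]
  rw [if_neg hd]
  by_cases hd1 : ∃ v, d = Finsupp.single v 1
  · obtain ⟨v, rfl⟩ := hd1
    exact h0 v
  · push Not at hd1
    exact coeff_eq_zero_of_totalDegree_le_one hp (Ne.symm hd) hd1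

end Affine

/-! ## Eliminating constant rows -/

section Elim

variable {K : Type*} [Field K] {σ τ : Type*}

/-- **One elimination step.**  For a square matrix `B` of size `m + 1` over `MvPolynomial σ K`
with `det B ≠ 0`, affine entries, row `a` reading only the variables in `S a`, and a CONSTANT
row `a₀` (`B a₀ b = C (v b)`): `det B = C κ · det B'` with `κ ≠ 0` and `B'` of size `m` affine,
its row `p` reading only the variables in `S (a₀.succAbove p)` (one column operation by a
unipotent `1 + e_{b₀} wᵀ`, then Laplace expansion along row `a₀`). [folklore] -/
theorem elim_step {m : ℕ} (B : Matrix (Fin (m + 1)) (Fin (m + 1)) (MvPolynomial σ K))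
    (S : Fin (m + 1) → Set σ) (hdeg : ∀ a b, (B a b).totalDegree ≤ 1)
    (hsupp : ∀ a b e, coeff (Finsupp.single e 1) (B a b) ≠ 0 → e ∈ S a)
    (a₀ : Fin (m + 1)) (v : Fin (m + 1) → K) (hrow : ∀ b, B a₀ b = C (v b)) (hdet : B.det ≠ 0) :
    ∃ (B' : Matrix (Fin m) (Fin m) (MvPolynomial σ K)) (κ : K), κ ≠ 0 ∧ B.det = C κ * B'.det ∧
      (∀ p q, (B' p q).totalDegree ≤ 1) ∧
      ∀ p q e, coeff (Finsupp.single e 1) (B' p q) ≠ 0 → e ∈ S (a₀.succAbove p) := by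
  classical
  -- a pivot column `b₀` with `v b₀ ≠ 0` (else row `a₀` vanishes and `det B = 0`)
  obtain ⟨b₀, hb₀⟩ : ∃ b₀, v b₀ ≠ 0 := by
    by_contra h
    push Not at h
    refine hdet (Matrix.det_eq_zero_of_row_eq_zero a₀ fun b => ?_)
    rw [hrow, h b, C_0]
  -- the column operation `B ↦ B₂ = B · (1 + e_{b₀} wᵀ)`, `w b₀ = 0`
  set w : Fin (m + 1) → K := fun b => if b = b₀ then 0 else -(v b / v b₀) with hw
  set B₂ : Matrix (Fin (m + 1)) (Fin (m + 1)) (MvPolynomial σ K) :=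
    Matrix.of fun a b => B a b + C (w b) * B a b₀ with hB₂
  have hB₂E : B₂ = B * (1 + Matrix.replicateCol Unit (Pi.single b₀ (1 : MvPolynomial σ K)) *
      Matrix.replicateRow Unit (fun b => C (w b))) := by
    rw [← Matrix.vecMulVec_eq, Matrix.mul_add, Matrix.mul_one, Matrix.mul_vecMulVec,
      Matrix.mulVec_single_one]
    ext a b
    simp only [hB₂, Matrix.of_apply, Matrix.add_apply, Matrix.vecMulVec_apply, Matrix.col_apply,
      mul_comm (C (w b))]
  have hdet₂ : B₂.det = B.det := by
    rw [hB₂E, Matrix.det_mul, Matrix.det_one_add_replicateCol_mul_replicateRow,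
      dotProduct_single, mul_one, hw]
    simp
  -- row `a₀` of `B₂` is `C (v b₀) · e_{b₀}`
  have hrow₂ : ∀ b, B₂ a₀ b = if b = b₀ then C (v b₀) else 0 := by
    intro b
    simp only [hB₂, Matrix.of_apply, hrow, hw]
    split_ifs with h
    · subst h
      rw [C_0, zero_mul, add_zero]
    · rw [← C_mul, ← C_add]
      convert C_0 using 2
      field_simp
      ring
  -- Laplace expansion along row `a₀`
  have hlap : B₂.det = (-1) ^ ((a₀ : ℕ) + b₀) * C (v b₀) *
      (B₂.submatrix a₀.succAbove b₀.succAbove).det := by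
    rw [Matrix.det_succ_row B₂ a₀, Finset.sum_eq_single b₀]
    · rw [hrow₂, if_pos rfl]
    · intro b _ hb
      rw [hrow₂, if_neg hb, mul_zero, zero_mul]
    · intro h
      exact absurd (Finset.mem_univ _) h
  refine ⟨B₂.submatrix a₀.succAbove b₀.succAbove, (-1) ^ ((a₀ : ℕ) + b₀) * v b₀,
    mul_ne_zero (pow_ne_zero _ (neg_ne_zero.mpr one_ne_zero)) hb₀, ?_, ?_, ?_⟩
  · rw [← hdet₂, hlap, map_mul, map_pow, map_neg, map_one]
  · intro p q
    simp only [Matrix.submatrix_apply, hB₂, Matrix.of_apply]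
    refine (totalDegree_add _ _).trans (max_le (hdeg _ _) ((totalDegree_mul _ _).trans ?_))
    rw [totalDegree_C, zero_add]
    exact hdeg _ _
  · intro p q e he
    simp only [Matrix.submatrix_apply, hB₂, Matrix.of_apply] at he
    by_contra hS
    rw [coeff_add, coeff_C_mul, not_not.mp (fun h => hS (hsupp _ _ _ h)),
      not_not.mp (fun h => hS (hsupp _ b₀ _ h)), mul_zero, add_zero] at he
    exact he rfl

/-- **Iterated elimination.**  Rows are coloured by `γ : Fin m → Option τ`: entries are affine
and a variable `e` (of colour `col e`) occurs linearly in row `a` only if `γ a = some (col e)`,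
so the rows with `γ a = none` are constant.  If `det B ≠ 0`, any `u ≤ #{a | γ a = none}` of them
can be eliminated (`elim_step`): `det B = C κ · det B'`, `κ ≠ 0`, `B'` coloured of size `m'`,
`m' + u ≤ m`. [folklore] -/
theorem elim_iter [DecidableEq τ] (col : σ → τ) :
    ∀ (u m : ℕ) (B : Matrix (Fin m) (Fin m) (MvPolynomial σ K)) (γ : Fin m → Option τ),
      (∀ a b, (B a b).totalDegree ≤ 1) →
      (∀ a b e, coeff (Finsupp.single e 1) (B a b) ≠ 0 → γ a = some (col e)) →
      u ≤ (Finset.univ.filter fun a => γ a = none).card → B.det ≠ 0 →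
      ∃ m' : ℕ, m' + u ≤ m ∧
        ∃ (B' : Matrix (Fin m') (Fin m') (MvPolynomial σ K)) (γ' : Fin m' → Option τ) (κ : K),
          κ ≠ 0 ∧ B.det = C κ * B'.det ∧ (∀ a b, (B' a b).totalDegree ≤ 1) ∧
          ∀ a b e, coeff (Finsupp.single e 1) (B' a b) ≠ 0 → γ' a = some (col e) := by
  intro u
  induction u with
  | zero =>
    intro m B γ hdeg hsupp _ _
    exact ⟨m, le_rfl, B, γ, 1, one_ne_zero, by rw [C_1, one_mul], hdeg, hsupp⟩
  | succ u ih =>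
    intro m B γ hdeg hsupp hu hdet
    -- a constant row `a₀`
    obtain ⟨a₀, ha₀⟩ : ∃ a₀, γ a₀ = none := by
      obtain ⟨a₀, h⟩ := Finset.card_pos.mp (by omega :
        0 < (Finset.univ.filter fun a => γ a = none).card)
      exact ⟨a₀, (Finset.mem_filter.mp h).2⟩
    obtain ⟨m₀, rfl⟩ : ∃ m₀, m = m₀ + 1 := ⟨m - 1, by have := a₀.pos; omega⟩
    have hrow : ∀ b, B a₀ b = C (coeff 0 (B a₀ b)) := fun b =>
      eq_C_of_forall_coeff_single_eq_zero (hdeg a₀ b) fun e => by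
        by_contra h
        have h' := hsupp a₀ b e h
        rw [ha₀] at h'
        exact Option.some_ne_none _ h'.symm
    obtain ⟨B₁, κ₁, hκ₁, hdet₁, hdeg₁, hsupp₁⟩ := elim_step B (fun a => {e | γ a = some (col e)})
      hdeg hsupp a₀ (fun b => coeff 0 (B a₀ b)) hrow hdet
    have hdetB₁ : B₁.det ≠ 0 := fun h => hdet (by rw [hdet₁, h, mul_zero])
    -- deleting the `none`-coloured row `a₀` lowers the count of `none`-coloured rows by one
    have hcount : u ≤ (Finset.univ.filter fun a => γ (a₀.succAbove a) = none).card := by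
      rw [Finset.card_filter, Fin.sum_univ_succAbove _ a₀, if_pos ha₀] at hu
      rw [Finset.card_filter]
      omega
    obtain ⟨m', hm', B', γ', κ', hκ', hdet', hdeg', hsupp'⟩ :=
      ih m₀ B₁ (fun a => γ (a₀.succAbove a)) hdeg₁ hsupp₁ hcount hdetB₁
    refine ⟨m', by omega, B', γ', κ₁ * κ', mul_ne_zero hκ₁ hκ', ?_, hdeg', hsupp'⟩
    rw [hdet₁, hdet', map_mul, mul_assoc]

end Elim

/-! ## The substitution `x_{•, j} ↦ e_0`, `x_{0, •} ↦ 0`, `x_{r+1, j.succAbove c} ↦ x_{r, c}` -/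

section Subst

variable {k : Type*} [CommSemiring k] {n : ℕ} (j : Fin (n + 1))
  (a : Fin (n + 1) × Fin (n + 1) → MvPolynomial (Fin n × Fin n) k)

/-- **`per_{n+1}` projects onto `per_n`**: under any substitution `a` with `a (0, j) = 1`,
`a (r+1, j) = 0` and `a (r+1, j.succAbove c) = X (r, c)`, the generic permanent of size `n + 1`
is sent to the generic permanent of size `n` (Laplace expansion along column `j`,
`Matrix.permanent_eq_sum_column`). [folklore] -/
theorem aeval_perPoly_succ (h0j : a (0, j) = 1) (hsj : ∀ r : Fin n, a (r.succ, j) = 0)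
    (hss : ∀ r c : Fin n, a (r.succ, j.succAbove c) = X (r, c)) :
    aeval a (perPoly (Fin (n + 1)) k) = perPoly (Fin n) k := by
  have h : aeval a (perPoly (Fin (n + 1)) k) = (Matrix.of fun i c => a (i, c)).permanent := by
    simp [perPoly, Matrix.permanent, map_sum, map_prod]
  have hsub : (Matrix.of fun i c => a (i, c)).submatrix (Fin.succAbove 0) j.succAbove =
      Matrix.mvPolynomialX (Fin n) (Fin n) k := by
    ext r c
    simp [Matrix.mvPolynomialX_apply, Fin.succAbove_zero, hss]
  rw [h, Matrix.permanent_eq_sum_column _ j, Fin.sum_univ_succ, hsub]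
  simp only [Matrix.of_apply, h0j, hsj, zero_mul, Finset.sum_const_zero, add_zero, one_mul]
  rfl

/-- Every value `a (r, c)` of the substitution is affine, and the only variable occurring in it
is `X (r', c')` with `r = r' + 1`, `c = j.succAbove c'`; in particular the new column `c'` is
determined by `c` (`finSuccEquiv' j c = some c'`). [folklore] -/
theorem subst_affine (h0j : a (0, j) = 1) (hsj : ∀ r : Fin n, a (r.succ, j) = 0)
    (h0s : ∀ c : Fin n, a (0, j.succAbove c) = 0)
    (hss : ∀ r c : Fin n, a (r.succ, j.succAbove c) = X (r, c)) (e : Fin (n + 1) × Fin (n + 1)) :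
    (a e).totalDegree ≤ 1 ∧ ∀ e' : Fin n × Fin n,
      coeff (Finsupp.single e' 1) (a e) ≠ 0 → finSuccEquiv' j e.2 = some e'.2 := by
  obtain ⟨r, c⟩ := e
  have hne : ∀ e' : Fin n × Fin n, (Finsupp.single e' 1 : Fin n × Fin n →₀ ℕ) ≠ 0 := fun e' =>
    Finsupp.single_ne_zero.mpr one_ne_zero
  rcases Fin.eq_self_or_eq_succAbove j c with rfl | ⟨c', rfl⟩ <;>
    refine Fin.cases ?_ (fun r' => ?_) r
  · rw [h0j, totalDegree_one, ← C_1]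
    exact ⟨Nat.zero_le _, fun e' he => absurd (coeff_C_of_ne_zero (hne e') _) he⟩
  · rw [hsj, totalDegree_zero]
    exact ⟨Nat.zero_le _, fun e' he => absurd (coeff_zero _) he⟩
  · rw [h0s, totalDegree_zero]
    exact ⟨Nat.zero_le _, fun e' he => absurd (coeff_zero _) he⟩
  · rw [hss]
    refine ⟨?_, fun e' he => ?_⟩
    · simpa [X, Finsupp.sum_single_index] using
        totalDegree_monomial_le (R := k) (Finsupp.single (r', c') 1) 1
    · rw [coeff_X] at he
      have h2 : (r', c') = e' := by
        by_contra h
        exact he (if_neg fun h' => h (Finsupp.single_left_injective one_ne_zero h'))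
      rw [← h2]
      exact finSuccEquiv'_succAbove j c'

end Subst

/-! ## The stub -/

/-- **S2 — deletion of a column block is exact surgery** (registered stub `stub_deletion` of line
`fat-row-recursion`, crux `DetQP.DetqpThesis`, stmt-ValiantsHypothesis-0315).  From a
row-partitioned affine determinantal representation `(A, β)` of `per_{n+1}` of size `M` (`n ≥ 1`)
and any column `j`, a row-partitioned representation `(A', β')` of `per_n` of size `M'` with
`M' + #{a | β a = j} ≤ M`: substitute `x_{•, j} ↦ e_0`, `x_{0, •} ↦ 0` (`per_{n+1} ↦ per_n`,
block `j` becomes constant), eliminate the constant rows one at a time by column operations and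
Laplace expansion (`elim_iter`), and absorb the unit into row `0`.  Hence `r(n) + u_j ≤ r(n+1)`
for the row-partitioned determinantal complexity `r`. [folklore] -/
theorem stub_deletion :
    ∀ (n : ℕ), 1 ≤ n →
      ∀ (M : ℕ) (A : Matrix (Fin M) (Fin M) (MvPolynomial (Fin (n + 1) × Fin (n + 1)) ℂ))
        (β : Fin M → Fin (n + 1)),
        IsAffineDetRepr (perPoly (Fin (n + 1)) ℂ) A →
        (∀ a b (e : Fin (n + 1) × Fin (n + 1)), coeff (Finsupp.single e 1) (A a b) ≠ 0 → e.2 = β a) →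
        ∀ j : Fin (n + 1),
          ∃ M' : ℕ, M' + (Finset.univ.filter fun a => β a = j).card ≤ M ∧
            ∃ (A' : Matrix (Fin M') (Fin M') (MvPolynomial (Fin n × Fin n) ℂ)) (β' : Fin M' → Fin n),
              IsAffineDetRepr (perPoly (Fin n) ℂ) A' ∧
              ∀ a b (e : Fin n × Fin n), coeff (Finsupp.single e 1) (A' a b) ≠ 0 → e.2 = β' a := by
  intro n hn M A β hA hβ j
  obtain ⟨hdeg, hdet⟩ := hA
  -- the substitution
  obtain ⟨a, h0j, hsj, h0s, hss⟩ :
      ∃ a : Fin (n + 1) × Fin (n + 1) → MvPolynomial (Fin n × Fin n) ℂ,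
        a (0, j) = 1 ∧ (∀ r : Fin n, a (r.succ, j) = 0) ∧ (∀ c : Fin n, a (0, j.succAbove c) = 0) ∧
        ∀ r c : Fin n, a (r.succ, j.succAbove c) = X (r, c) :=
    ⟨fun p => Fin.cases (motive := fun _ => MvPolynomial (Fin n × Fin n) ℂ)
        ((finSuccEquiv' j p.2).elim 1 fun _ => 0)
        (fun r => (finSuccEquiv' j p.2).elim 0 fun c => X (r, c)) p.1,
      by simp, fun r => by simp, fun c => by simp, fun r c => by simp⟩
  have ha := subst_affine j a h0j hsj h0s hss
  -- the substituted matrix, recoloured by `finSuccEquiv' j ∘ β`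
  set A₂ : Matrix (Fin M) (Fin M) (MvPolynomial (Fin n × Fin n) ℂ) := (aeval a).mapMatrix A
    with hA₂
  have hdet₂ : A₂.det = perPoly (Fin n) ℂ := by
    rw [hA₂, ← AlgHom.map_det, hdet, aeval_perPoly_succ j a h0j hsj hss]
  have hdeg₂ : ∀ i b, (A₂ i b).totalDegree ≤ 1 := fun i b =>
    (HasDetRepr.totalDegree_aeval_le_of_le_one a (fun e => (ha e).1) _).trans (hdeg i b)
  have hsupp₂ : ∀ i b (e : Fin n × Fin n), coeff (Finsupp.single e 1) (A₂ i b) ≠ 0 →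
      finSuccEquiv' j (β i) = some e.2 := by
    intro i b e he
    obtain ⟨e₀, he₀, hae₀⟩ := exists_coeff_ne_zero_of_coeff_aeval_ne_zero a (hdeg i b) he
    rw [← hβ i b e₀ he₀]
    exact (ha e₀).2 e hae₀
  have hcard : (Finset.univ.filter fun i => finSuccEquiv' j (β i) = none) =
      (Finset.univ.filter fun i => β i = j) :=
    Finset.filter_congr fun i _ => by rw [finSuccEquiv'_eq_none, eq_comm]
  have hne : A₂.det ≠ 0 := by
    rw [hdet₂]
    exact perPoly_ne_zero _ _
  -- eliminate the constant rows (block `j`)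
  obtain ⟨m', hm', B', γ', κ, -, hdetB, hdeg', hsupp'⟩ :=
    elim_iter (K := ℂ) (Prod.snd : Fin n × Fin n → Fin n)
      (Finset.univ.filter fun i => β i = j).card M A₂ (fun i => finSuccEquiv' j (β i))
      hdeg₂ hsupp₂ (congrArg Finset.card hcard).ge hne
  -- `m' ≥ 1`: `per_n` is not a constant
  obtain ⟨m'', rfl⟩ : ∃ m'', m' = m'' + 1 := by
    rcases m' with _ | m''
    · exfalso
      have h1 : perPoly (Fin n) ℂ = C κ := by
        rw [← hdet₂, hdetB, Matrix.det_fin_zero, mul_one]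
      have h2 := totalDegree_perPoly_holds (n := Fin n) (k := ℂ)
      rw [h1, totalDegree_C, Fintype.card_fin] at h2
      omega
    · exact ⟨m'', rfl⟩
  -- absorb the unit `C κ` into row `0`
  have hn0 : 0 < n := Nat.lt_of_lt_of_le Nat.zero_lt_one hn
  refine ⟨m'' + 1, hm', B'.updateRow 0 ((C κ : MvPolynomial (Fin n × Fin n) ℂ) • B' 0),
    fun i => (γ' i).getD ⟨0, hn0⟩, ⟨fun i b => ?_, ?_⟩, fun i b e he => ?_⟩
  · rw [Matrix.updateRow_apply]
    split_ifs with h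
    · rw [Pi.smul_apply, smul_eq_mul]
      refine (totalDegree_mul _ _).trans ?_
      rw [totalDegree_C, zero_add]
      exact hdeg' 0 b
    · exact hdeg' i b
  · rw [Matrix.det_updateRow_smul, Matrix.updateRow_eq_self, ← hdetB, hdet₂]
  · show e.2 = (γ' i).getD ⟨0, hn0⟩
    rw [Matrix.updateRow_apply] at he
    split_ifs at he with h
    · rw [Pi.smul_apply, smul_eq_mul, coeff_C_mul] at he
      rw [h, hsupp' 0 b e (right_ne_zero_of_mul he), Option.getD_some]
    · rw [hsupp' i b e he, Option.getD_some]

end Summit.ValiantsHypothesis.ValiantsHypothesis.Theorems.DetQPDetqpThesis.FatRowDeletion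

end
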